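import Mathlib
import HarnessLib
import Summits.Ventures.LatticeQCDFlow.Exactness.U1WilsonFlowLOTranslation
import Summits.Ventures.LatticeQCDFlow.Exactness.SU2WilsonFlowLOMemberContinuity
import Summits.Ventures.LatticeQCDFlow.Exactness.U1PlaquetteLift
import Literature.MathematicalPhysics.QuantumLattice.GaugeGroups
import Literature.Barriers.QuantumFields.ElitzurTheorem

/-!
# `U(1)` rung: the LO Wilson-flow member and its pulled-back action are CONTINUOUS — FT-HMC through the member with the exact-gradient force and `S = β·S_W` commutes with every gauge transformation and every mask-preserving translation, nothing left to assume

HONEST FRAMING: exact (Metropolis-corrected) sampling algorithms for lattice gauge theory;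
figures of merit are autocorrelation/cost numbers at stated couplings and volumes; no
continuum-physics claim.

Venture `LatticeQCDFlow` (cell pub-lqcd), topic `Exactness`; FANOUT row 14 (`eng-flowhmc`, `U(1)`
rung, member `maps.u1_wilson_flow_lo`).  NEW WORK of the cell; nothing is cited as a fact; no
number.  The `U(1)` twin of GEN-10's `SU2WilsonFlowLOContinuity` / `SU2WilsonFlowLOMemberContinuity`:
the exact-force kernel theorems on this rung (`U1FTHMCGaugeCovariance.u1_fthmc_exactForce_conjKernel_gaugeTransform`,
`U1WilsonFlowLOTranslation.u1_fthmc_wilsonFlowLO_exactForce_translationCovariant`) carry ONE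
certificate, continuity of `S̃ = S∘F − log J`; it is discharged here for the LO member.

* `continuous_u1WilsonFlowLOSubstepFun`, `continuous_u1WilsonFlowLOJacobian` — the masked `U(1)`
  sub-step (formulas VERBATIM as in `exists_layers_u1WilsonFlowLO`) and its booked density
  `∏_active (1 − εC)` are continuous functions of the field (`U1PlaquetteLift.continuous_u1Drift` /
  `continuous_u1Factor`);
* **`u1WilsonFlowLO_member_continuous`**, **`u1WilsonFlowLO_member_ftAction_continuous`** — for ANY
  schedule packaged as in `exists_layers_u1WilsonFlowLO`: composite and running log-det continuous,
  `S∘F − log J` continuous for every continuous `S` (generic `continuous_of_layers_map_eq` /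
  `continuous_foldr_trans` / `continuous_foldr_logDet` / `foldr_logDet_pos`);
* **`u1_fthmc_wilsonFlowLO_wilson_exactForce_gaugeCovariant`** — proper colouring, `2(d−1)|ε| < 1`,
  ANY schedule, `S = β·S_W` (defining representation `u1Rep`): FT-HMC through the LO member with the
  EXACT gradient force commutes with EVERY gauge transformation — nothing left to assume;
* **`u1_fthmc_wilsonFlowLO_wilson_exactForce_translationCovariant`** — the same for every
  mask-preserving lattice translation (`χ (x + t) = χ x`).

NOT CLAIMED: translations permuting the colour classes; floating point; any number.
-/

noncomputable section

namespace Summit.Ventures.LatticeQCDFlow.Exactness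

open Set MeasureTheory
open ProbabilityTheory ProbabilityTheory.Kernel
open Literature.MathematicalPhysics.QuantumFieldTheory Literature.MathematicalPhysics.QuantumLattice
open Literature.Barriers.QuantumFields
open scoped ENNReal

variable {d L : ℕ} {X : Type*} [DecidableEq X] (χ : Site d L → X)

/-! ## Continuity of the sub-step, its density, the member and `S̃` -/

section Continuity

/-- The masked `U(1)` Wilson-flow sub-step is a continuous function of the field. -/
theorem continuous_u1WilsonFlowLOSubstepFun (μ : Fin d) (b : X) (ε : ℝ) :
    Continuous (fun (V : GaugeConfig d L Circle) (e : Edge d L) => if e.2 = μ ∧ χ e.1 = b then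
          V e * Circle.exp (ε * ∑ ν ∈ Finset.univ.erase e.2,
            (((plaquetteHolonomy V (e.1 - Pi.single ν 1) e.2 ν : Circle) : ℂ).im -
              ((plaquetteHolonomy V e.1 e.2 ν : Circle) : ℂ).im)) else V e) := by
  refine continuous_pi fun e => ?_
  by_cases he : e.2 = μ ∧ χ e.1 = b
  · simp only [if_pos he]
    exact (continuous_apply e).mul (Circle.exp.continuous.comp (continuous_u1Drift e ε))
  · simp only [if_neg he]
    exact continuous_apply e

variable [NeZero L]

/-- The booked density of the masked `U(1)` sub-step is a continuous function of the field. -/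
theorem continuous_u1WilsonFlowLOJacobian (μ : Fin d) (b : X) (ε : ℝ) :
    Continuous (fun V : GaugeConfig d L Circle => ∏ a : {e : Edge d L // e.2 = μ ∧ χ e.1 = b},
          (1 - ε * ∑ ν ∈ Finset.univ.erase a.1.2,
            (((plaquetteHolonomy V a.1.1 a.1.2 ν : Circle) : ℂ).re +
              ((plaquetteHolonomy V (a.1.1 - Pi.single ν 1) a.1.2 ν : Circle) : ℂ).re))) :=
  continuous_finsetProd _ fun a _ => continuous_u1Factor a.1 ε

/-- **The `U(1)` LO member is continuous** (composite and running log-det), for ANY `layers`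
packaged as in `exists_layers_u1WilsonFlowLO`. -/
theorem u1WilsonFlowLO_member_continuous (ε : ℝ) (sched : List (Fin d × X)) (layers : List ((GaugeConfig d L Circle ≃ᵐ GaugeConfig d L Circle) × (GaugeConfig d L Circle → ℝ)))
    (hmap :
      layers.map (fun Ly => ((Ly.1 : GaugeConfig d L Circle → GaugeConfig d L Circle), Ly.2)) = sched.map (fun s =>
        ((fun (V : GaugeConfig d L Circle) (e : Edge d L) => if e.2 = s.1 ∧ χ e.1 = s.2 then
          V e * Circle.exp (ε * ∑ ν ∈ Finset.univ.erase e.2,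
            (((plaquetteHolonomy V (e.1 - Pi.single ν 1) e.2 ν : Circle) : ℂ).im -
              ((plaquetteHolonomy V e.1 e.2 ν : Circle) : ℂ).im)) else V e),
         fun V : GaugeConfig d L Circle => ∏ a : {e : Edge d L // e.2 = s.1 ∧ χ e.1 = s.2},
          (1 - ε * ∑ ν ∈ Finset.univ.erase a.1.2,
            (((plaquetteHolonomy V a.1.1 a.1.2 ν : Circle) : ℂ).re +
              ((plaquetteHolonomy V (a.1.1 - Pi.single ν 1) a.1.2 ν : Circle) : ℂ).re))))) :
    Continuous (⇑(layers.foldr (fun Ly (F : GaugeConfig d L Circle ≃ᵐ GaugeConfig d L Circle) => Ly.1.trans F) (MeasurableEquiv.refl (GaugeConfig d L Circle)))) ∧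
    Continuous (layers.foldr (fun Ly K => fun v => Ly.2 v * K (Ly.1 v)) (fun _ => (1 : ℝ))) := by
  have key := continuous_of_layers_map_eq layers sched
    (fun s => (fun (V : GaugeConfig d L Circle) (e : Edge d L) => if e.2 = s.1 ∧ χ e.1 = s.2 then
          V e * Circle.exp (ε * ∑ ν ∈ Finset.univ.erase e.2,
            (((plaquetteHolonomy V (e.1 - Pi.single ν 1) e.2 ν : Circle) : ℂ).im -
              ((plaquetteHolonomy V e.1 e.2 ν : Circle) : ℂ).im)) else V e))
    (fun s => fun V : GaugeConfig d L Circle => ∏ a : {e : Edge d L // e.2 = s.1 ∧ χ e.1 = s.2},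
          (1 - ε * ∑ ν ∈ Finset.univ.erase a.1.2,
            (((plaquetteHolonomy V a.1.1 a.1.2 ν : Circle) : ℂ).re +
              ((plaquetteHolonomy V (a.1.1 - Pi.single ν 1) a.1.2 ν : Circle) : ℂ).re)))
    hmap
    (fun s _ => continuous_u1WilsonFlowLOSubstepFun χ s.1 s.2 ε)
    (fun s _ => continuous_u1WilsonFlowLOJacobian χ s.1 s.2 ε)
  exact ⟨continuous_foldr_trans layers key.1, continuous_foldr_logDet layers key.1 key.2⟩

/-- **Hence `S̃ = S∘F − log J` of the `U(1)` LO member is continuous** for every continuous `S`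
(positive booked densities, as `exists_layers_u1WilsonFlowLO` provides). -/
theorem u1WilsonFlowLO_member_ftAction_continuous (ε : ℝ) (sched : List (Fin d × X)) (layers : List ((GaugeConfig d L Circle ≃ᵐ GaugeConfig d L Circle) × (GaugeConfig d L Circle → ℝ)))
    (hmap :
      layers.map (fun Ly => ((Ly.1 : GaugeConfig d L Circle → GaugeConfig d L Circle), Ly.2)) = sched.map (fun s =>
        ((fun (V : GaugeConfig d L Circle) (e : Edge d L) => if e.2 = s.1 ∧ χ e.1 = s.2 then
          V e * Circle.exp (ε * ∑ ν ∈ Finset.univ.erase e.2,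
            (((plaquetteHolonomy V (e.1 - Pi.single ν 1) e.2 ν : Circle) : ℂ).im -
              ((plaquetteHolonomy V e.1 e.2 ν : Circle) : ℂ).im)) else V e),
         fun V : GaugeConfig d L Circle => ∏ a : {e : Edge d L // e.2 = s.1 ∧ χ e.1 = s.2},
          (1 - ε * ∑ ν ∈ Finset.univ.erase a.1.2,
            (((plaquetteHolonomy V a.1.1 a.1.2 ν : Circle) : ℂ).re +
              ((plaquetteHolonomy V (a.1.1 - Pi.single ν 1) a.1.2 ν : Circle) : ℂ).re)))))
    (hpos : ∀ Ly ∈ layers, ∀ V, 0 < Ly.2 V) {S : GaugeConfig d L Circle → ℝ} (hS : Continuous S) :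
    Continuous fun W : GaugeConfig d L Circle => S ((layers.foldr (fun Ly (F : GaugeConfig d L Circle ≃ᵐ GaugeConfig d L Circle) => Ly.1.trans F) (MeasurableEquiv.refl (GaugeConfig d L Circle))) W) - Real.log ((layers.foldr (fun Ly K => fun v => Ly.2 v * K (Ly.1 v)) (fun _ => (1 : ℝ))) W) := by
  obtain ⟨hF, hJ⟩ := u1WilsonFlowLO_member_continuous χ ε sched layers hmap
  exact (hS.comp hF).sub (Real.continuousOn_log.comp_continuous hJ fun W =>
    (foldr_logDet_pos layers hpos W).ne')

end Continuity

/-! ## Nothing left to assume: `S = β·S_W`, exact force, gauge transformations and translations -/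

section Wilson

variable [NeZero L]

/-- **`U(1)` FT-HMC through the LO member with the EXACT gradient force of `β S_W∘F − log J` commutes
with EVERY gauge transformation — nothing left to assume** (proper colouring, `2(d−1)|ε| < 1`, any
schedule, any `β, c, κ, n, h`). -/
theorem u1_fthmc_wilsonFlowLO_wilson_exactForce_gaugeCovariant
    (hχ : ∀ (x : Site d L) (i : Fin d), χ (x.shift i) ≠ χ x) {ε : ℝ}
    (hε : |ε| * (2 * ((d - 1 : ℕ) : ℝ)) < 1) (sched : List (Fin d × X)) (β : ℝ) :
    ∃ layers : List ((GaugeConfig d L Circle ≃ᵐ GaugeConfig d L Circle) × (GaugeConfig d L Circle → ℝ)),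
      layers.map (fun Ly => ((Ly.1 : GaugeConfig d L Circle → GaugeConfig d L Circle), Ly.2)) = sched.map (fun s =>
        ((fun (V : GaugeConfig d L Circle) (e : Edge d L) => if e.2 = s.1 ∧ χ e.1 = s.2 then
          V e * Circle.exp (ε * ∑ ν ∈ Finset.univ.erase e.2,
            (((plaquetteHolonomy V (e.1 - Pi.single ν 1) e.2 ν : Circle) : ℂ).im -
              ((plaquetteHolonomy V e.1 e.2 ν : Circle) : ℂ).im)) else V e),
         fun V : GaugeConfig d L Circle => ∏ a : {e : Edge d L // e.2 = s.1 ∧ χ e.1 = s.2},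
          (1 - ε * ∑ ν ∈ Finset.univ.erase a.1.2,
            (((plaquetteHolonomy V a.1.1 a.1.2 ν : Circle) : ℂ).re +
              ((plaquetteHolonomy V (a.1.1 - Pi.single ν 1) a.1.2 ν : Circle) : ℂ).re)))) ∧
      (Continuous fun W : GaugeConfig d L Circle => β * wilsonAction u1Rep ((layers.foldr (fun Ly (F : GaugeConfig d L Circle ≃ᵐ GaugeConfig d L Circle) => Ly.1.trans F) (MeasurableEquiv.refl (GaugeConfig d L Circle))) W) - Real.log ((layers.foldr (fun Ly K => fun v => Ly.2 v * K (Ly.1 v)) (fun _ => (1 : ℝ))) W)) ∧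
      ∀ (h : Site d L → Circle)
        (hSc : Continuous fun W : GaugeConfig d L Circle => β * wilsonAction u1Rep ((layers.foldr (fun Ly (F : GaugeConfig d L Circle ≃ᵐ GaugeConfig d L Circle) => Ly.1.trans F) (MeasurableEquiv.refl (GaugeConfig d L Circle))) W) - Real.log ((layers.foldr (fun Ly K => fun v => Ly.2 v * K (Ly.1 v)) (fun _ => (1 : ℝ))) W)) (c κ : ℝ) (n : ℕ),
    conjKernel
      (conjKernel
        (refreshUpdate
          (involMH
            (⇑((flip : Equiv.Perm (GaugeConfig d L Circle × (Edge d L → ℝ))) *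
                leapfrog (mulDrift (fun p : Edge d L → ℝ => fun i : Edge d L => Circle.exp (c * p i))) (fun V : GaugeConfig d L Circle => (fun i : Edge d L => κ * fderiv ℝ (fun p : (Edge d L → ℝ) => (fun W : GaugeConfig d L Circle => β * wilsonAction u1Rep ((layers.foldr (fun Ly (F : GaugeConfig d L Circle ≃ᵐ GaugeConfig d L Circle) => Ly.1.trans F) (MeasurableEquiv.refl (GaugeConfig d L Circle))) W) - Real.log ((layers.foldr (fun Ly K => fun v => Ly.2 v * K (Ly.1 v)) (fun _ => (1 : ℝ))) W)) ((fun i : Edge d L => Circle.exp (c * p i)) * V)) 0 (Pi.single i 1))) ^ n))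
            (measurable_flip_leapfrog_pow (measurable_mulDrift (measurable_circleDrift c)) (measurable_u1ExactForce hSc c κ) n)
            fun z : GaugeConfig d L Circle × (Edge d L → ℝ) =>
              (β * wilsonAction u1Rep ((layers.foldr (fun Ly (F : GaugeConfig d L Circle ≃ᵐ GaugeConfig d L Circle) => Ly.1.trans F) (MeasurableEquiv.refl (GaugeConfig d L Circle))) z.1) - Real.log ((layers.foldr (fun Ly K => fun v => Ly.2 v * K (Ly.1 v)) (fun _ => (1 : ℝ))) z.1)) + ∑ i, z.2 i ^ 2 / 2)
          ((((volume : Measure (Edge d L → ℝ)).withDensity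
                  fun p => ENNReal.ofReal (Real.exp (-(∑ i, p i ^ 2 / 2)))) Set.univ)⁻¹ •
              (volume : Measure (Edge d L → ℝ)).withDensity
                fun p => ENNReal.ofReal (Real.exp (-(∑ i, p i ^ 2 / 2)))))
        (layers.foldr (fun Ly (F : GaugeConfig d L Circle ≃ᵐ GaugeConfig d L Circle) => Ly.1.trans F) (MeasurableEquiv.refl (GaugeConfig d L Circle))))
      (Elitzur.gaugeTransformMEquiv h) =
      (conjKernel
        (refreshUpdate
          (involMH
            (⇑((flip : Equiv.Perm (GaugeConfig d L Circle × (Edge d L → ℝ))) *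
                leapfrog (mulDrift (fun p : Edge d L → ℝ => fun i : Edge d L => Circle.exp (c * p i))) (fun V : GaugeConfig d L Circle => (fun i : Edge d L => κ * fderiv ℝ (fun p : (Edge d L → ℝ) => (fun W : GaugeConfig d L Circle => β * wilsonAction u1Rep ((layers.foldr (fun Ly (F : GaugeConfig d L Circle ≃ᵐ GaugeConfig d L Circle) => Ly.1.trans F) (MeasurableEquiv.refl (GaugeConfig d L Circle))) W) - Real.log ((layers.foldr (fun Ly K => fun v => Ly.2 v * K (Ly.1 v)) (fun _ => (1 : ℝ))) W)) ((fun i : Edge d L => Circle.exp (c * p i)) * V)) 0 (Pi.single i 1))) ^ n))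
            (measurable_flip_leapfrog_pow (measurable_mulDrift (measurable_circleDrift c)) (measurable_u1ExactForce hSc c κ) n)
            fun z : GaugeConfig d L Circle × (Edge d L → ℝ) =>
              (β * wilsonAction u1Rep ((layers.foldr (fun Ly (F : GaugeConfig d L Circle ≃ᵐ GaugeConfig d L Circle) => Ly.1.trans F) (MeasurableEquiv.refl (GaugeConfig d L Circle))) z.1) - Real.log ((layers.foldr (fun Ly K => fun v => Ly.2 v * K (Ly.1 v)) (fun _ => (1 : ℝ))) z.1)) + ∑ i, z.2 i ^ 2 / 2)
          ((((volume : Measure (Edge d L → ℝ)).withDensity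
                  fun p => ENNReal.ofReal (Real.exp (-(∑ i, p i ^ 2 / 2)))) Set.univ)⁻¹ •
              (volume : Measure (Edge d L → ℝ)).withDensity
                fun p => ENNReal.ofReal (Real.exp (-(∑ i, p i ^ 2 / 2)))))
        (layers.foldr (fun Ly (F : GaugeConfig d L Circle ≃ᵐ GaugeConfig d L Circle) => Ly.1.trans F) (MeasurableEquiv.refl (GaugeConfig d L Circle)))) := by
  obtain ⟨layers, hmap, hpos, hmeas, -⟩ := exists_layers_u1WilsonFlowLO χ hχ hε sched
  have hgauge := u1WilsonFlowLO_member_gauge χ ε sched layers hmap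
  have hSc0 : Continuous fun U : GaugeConfig d L Circle => β * wilsonAction u1Rep U :=
    continuous_const.mul (Elitzur.continuous_wilsonAction _ continuous_u1Rep)
  have hSi : IsGaugeInvariant fun U : GaugeConfig d L Circle => β * wilsonAction u1Rep U :=
    fun g U => by simp only [wilsonAction_gaugeTransform]
  refine ⟨layers, hmap, u1WilsonFlowLO_member_ftAction_continuous χ ε sched layers hmap hpos hSc0, ?_⟩
  intro h hSW c κ n
  exact u1_fthmc_exactForce_conjKernel_gaugeTransform h _ hgauge.1 (measurable_foldr_logDet layers hmeas)
    hgauge.2 hSc0.measurable hSi hSW c κ n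

/-- **… and with every mask-preserving lattice translation — nothing left to assume** (`χ (x + t) = χ x`;
translation invariance of `S_W` by `wilsonAction_comp_translate`). -/
theorem u1_fthmc_wilsonFlowLO_wilson_exactForce_translationCovariant
    (hχ : ∀ (x : Site d L) (i : Fin d), χ (x.shift i) ≠ χ x) {ε : ℝ}
    (hε : |ε| * (2 * ((d - 1 : ℕ) : ℝ)) < 1) (sched : List (Fin d × X)) (β : ℝ) :
    ∃ layers : List ((GaugeConfig d L Circle ≃ᵐ GaugeConfig d L Circle) × (GaugeConfig d L Circle → ℝ)),
      layers.map (fun Ly => ((Ly.1 : GaugeConfig d L Circle → GaugeConfig d L Circle), Ly.2)) = sched.map (fun s =>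
        ((fun (V : GaugeConfig d L Circle) (e : Edge d L) => if e.2 = s.1 ∧ χ e.1 = s.2 then
          V e * Circle.exp (ε * ∑ ν ∈ Finset.univ.erase e.2,
            (((plaquetteHolonomy V (e.1 - Pi.single ν 1) e.2 ν : Circle) : ℂ).im -
              ((plaquetteHolonomy V e.1 e.2 ν : Circle) : ℂ).im)) else V e),
         fun V : GaugeConfig d L Circle => ∏ a : {e : Edge d L // e.2 = s.1 ∧ χ e.1 = s.2},
          (1 - ε * ∑ ν ∈ Finset.univ.erase a.1.2,
            (((plaquetteHolonomy V a.1.1 a.1.2 ν : Circle) : ℂ).re +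
              ((plaquetteHolonomy V (a.1.1 - Pi.single ν 1) a.1.2 ν : Circle) : ℂ).re)))) ∧
      (Continuous fun W : GaugeConfig d L Circle => β * wilsonAction u1Rep ((layers.foldr (fun Ly (F : GaugeConfig d L Circle ≃ᵐ GaugeConfig d L Circle) => Ly.1.trans F) (MeasurableEquiv.refl (GaugeConfig d L Circle))) W) - Real.log ((layers.foldr (fun Ly K => fun v => Ly.2 v * K (Ly.1 v)) (fun _ => (1 : ℝ))) W)) ∧
      ∀ (t : Site d L) (_ht : ∀ x : Site d L, χ (x + t) = χ x)
        (hSc : Continuous fun W : GaugeConfig d L Circle => β * wilsonAction u1Rep ((layers.foldr (fun Ly (F : GaugeConfig d L Circle ≃ᵐ GaugeConfig d L Circle) => Ly.1.trans F) (MeasurableEquiv.refl (GaugeConfig d L Circle))) W) - Real.log ((layers.foldr (fun Ly K => fun v => Ly.2 v * K (Ly.1 v)) (fun _ => (1 : ℝ))) W)) (c κ : ℝ) (n : ℕ),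
    conjKernel
      (conjKernel
        (refreshUpdate
          (involMH
            (⇑((flip : Equiv.Perm (GaugeConfig d L Circle × (Edge d L → ℝ))) *
                leapfrog (mulDrift (fun p : Edge d L → ℝ => fun i : Edge d L => Circle.exp (c * p i))) (fun V : GaugeConfig d L Circle => (fun i : Edge d L => κ * fderiv ℝ (fun p : (Edge d L → ℝ) => (fun W : GaugeConfig d L Circle => β * wilsonAction u1Rep ((layers.foldr (fun Ly (F : GaugeConfig d L Circle ≃ᵐ GaugeConfig d L Circle) => Ly.1.trans F) (MeasurableEquiv.refl (GaugeConfig d L Circle))) W) - Real.log ((layers.foldr (fun Ly K => fun v => Ly.2 v * K (Ly.1 v)) (fun _ => (1 : ℝ))) W)) ((fun i : Edge d L => Circle.exp (c * p i)) * V)) 0 (Pi.single i 1))) ^ n))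
            (measurable_flip_leapfrog_pow (measurable_mulDrift (measurable_circleDrift c)) (measurable_u1ExactForce hSc c κ) n)
            fun z : GaugeConfig d L Circle × (Edge d L → ℝ) =>
              (β * wilsonAction u1Rep ((layers.foldr (fun Ly (F : GaugeConfig d L Circle ≃ᵐ GaugeConfig d L Circle) => Ly.1.trans F) (MeasurableEquiv.refl (GaugeConfig d L Circle))) z.1) - Real.log ((layers.foldr (fun Ly K => fun v => Ly.2 v * K (Ly.1 v)) (fun _ => (1 : ℝ))) z.1)) + ∑ i, z.2 i ^ 2 / 2)
          ((((volume : Measure (Edge d L → ℝ)).withDensity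
                  fun p => ENNReal.ofReal (Real.exp (-(∑ i, p i ^ 2 / 2)))) Set.univ)⁻¹ •
              (volume : Measure (Edge d L → ℝ)).withDensity
                fun p => ENNReal.ofReal (Real.exp (-(∑ i, p i ^ 2 / 2)))))
        (layers.foldr (fun Ly (F : GaugeConfig d L Circle ≃ᵐ GaugeConfig d L Circle) => Ly.1.trans F) (MeasurableEquiv.refl (GaugeConfig d L Circle))))
      ({ toFun := fun V : GaugeConfig d L Circle => (fun e : Edge d L => V (e.1 + t, e.2)),
         invFun := fun V : GaugeConfig d L Circle => (fun e : Edge d L => V (e.1 - t, e.2)),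
         left_inv := fun V => funext fun e => by simp only [sub_add_cancel],
         right_inv := fun V => funext fun e => by simp only [add_sub_cancel_right],
         measurable_toFun := measurable_pi_lambda _ fun e => measurable_pi_apply _,
         measurable_invFun := measurable_pi_lambda _ fun e => measurable_pi_apply _ } : GaugeConfig d L Circle ≃ᵐ GaugeConfig d L Circle) =
      (conjKernel
        (refreshUpdate
          (involMH
            (⇑((flip : Equiv.Perm (GaugeConfig d L Circle × (Edge d L → ℝ))) *
                leapfrog (mulDrift (fun p : Edge d L → ℝ => fun i : Edge d L => Circle.exp (c * p i))) (fun V : GaugeConfig d L Circle => (fun i : Edge d L => κ * fderiv ℝ (fun p : (Edge d L → ℝ) => (fun W : GaugeConfig d L Circle => β * wilsonAction u1Rep ((layers.foldr (fun Ly (F : GaugeConfig d L Circle ≃ᵐ GaugeConfig d L Circle) => Ly.1.trans F) (MeasurableEquiv.refl (GaugeConfig d L Circle))) W) - Real.log ((layers.foldr (fun Ly K => fun v => Ly.2 v * K (Ly.1 v)) (fun _ => (1 : ℝ))) W)) ((fun i : Edge d L => Circle.exp (c * p i)) * V)) 0 (Pi.single i 1))) ^ n))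
            (measurable_flip_leapfrog_pow (measurable_mulDrift (measurable_circleDrift c)) (measurable_u1ExactForce hSc c κ) n)
            fun z : GaugeConfig d L Circle × (Edge d L → ℝ) =>
              (β * wilsonAction u1Rep ((layers.foldr (fun Ly (F : GaugeConfig d L Circle ≃ᵐ GaugeConfig d L Circle) => Ly.1.trans F) (MeasurableEquiv.refl (GaugeConfig d L Circle))) z.1) - Real.log ((layers.foldr (fun Ly K => fun v => Ly.2 v * K (Ly.1 v)) (fun _ => (1 : ℝ))) z.1)) + ∑ i, z.2 i ^ 2 / 2)
          ((((volume : Measure (Edge d L → ℝ)).withDensity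
                  fun p => ENNReal.ofReal (Real.exp (-(∑ i, p i ^ 2 / 2)))) Set.univ)⁻¹ •
              (volume : Measure (Edge d L → ℝ)).withDensity
                fun p => ENNReal.ofReal (Real.exp (-(∑ i, p i ^ 2 / 2)))))
        (layers.foldr (fun Ly (F : GaugeConfig d L Circle ≃ᵐ GaugeConfig d L Circle) => Ly.1.trans F) (MeasurableEquiv.refl (GaugeConfig d L Circle)))) := by
  obtain ⟨layers, hmap, hpos, hmeas, -⟩ := exists_layers_u1WilsonFlowLO χ hχ hε sched
  have hSc0 : Continuous fun U : GaugeConfig d L Circle => β * wilsonAction u1Rep U :=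
    continuous_const.mul (Elitzur.continuous_wilsonAction _ continuous_u1Rep)
  refine ⟨layers, hmap, u1WilsonFlowLO_member_ftAction_continuous χ ε sched layers hmap hpos hSc0, ?_⟩
  intro t ht hSW c κ n
  have hm := u1WilsonFlowLO_member_translate χ t ht ε sched layers hmap
  have hSi : ∀ V : GaugeConfig d L Circle, (fun U : GaugeConfig d L Circle => β * wilsonAction u1Rep U) (fun e : Edge d L => V (e.1 + t, e.2)) = (fun U : GaugeConfig d L Circle => β * wilsonAction u1Rep U) V :=
    fun V => by
      beta_reduce
      rw [wilsonAction_comp_translate]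
  exact u1_fthmc_exactForce_conjKernel_translate t _ hm.1 (measurable_foldr_logDet layers hmeas) hm.2
    hSc0.measurable hSi hSW c κ n

end Wilson

end Summit.Ventures.LatticeQCDFlow.Exactness
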